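import Summits.CriticalPhenomena.PercolationContinuityZ3.Theorems.PercNearOneGluingAdditiveGluingKnThm1Set
import Summits.CriticalPhenomena.PercolationContinuityZ3.Theorems.PercNearOneGluingAdditiveGluingBlockGrowth
import HarnessLib

/-! # Crux `PercNearOneGluing.AdditiveGluing` (stmt-CriticalPhenomena-4576), residual kernel `residualKernel_two` —
# Kozma–Nitzan's Lemma 4 (pair pivotality) and the SHALLOW leaf of the two-block kernel

TTRL deep seat `ttrlatt-v13181-d0` (variant V13181 = structure class `residualKernel_two_A4_a0neb` of the residual
kernel `hres` of `goodStep_of_residualKernel`: `S.card = 2`, `A.card = 4`, `a₀ ≠ b`).  Lands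
`--supports stmt-CriticalPhenomena-4576`; no definitions, no named facts.  Discharges the filed item wi-38625
(KN Lemma 4 / eq. (9) in the crux's model) as a `--supports` lemma, as that item asks.

* `knLemma4_pair_core`, `knLemma4_pair` (**KN Lemma 4, eq. (8)**): for all vertices `a₀, s₁, s₂, b`,
  `μ(a₀ ↮ b, a₀ ↔ {s₁,s₂}, {s₁,s₂} ↔ b) ≤ μ({s₁,s₂} ↔ b) − min_j μ(s_j ↔ b)`:
  the probability that the pair `{s₁, s₂}` is pivotal for `a₀ ↔ b` (gluing the pair joins `a₀` to `b`) is at most the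
  larger of the probabilities that it is pivotal for `s_j ↔ b`.  Proof as in print: KN Theorem 1 (pre-FKG (3) for two
  relays, landed `stub_knThm1Set`, observer `{a₀}`, relays `s₁, s₂`), subtract `μ(a₀ ↔ s₂ ↔ b)`, enlarge, add
  `μ(s₁ ↔ b, s₂ ↔ a₀, s₁ ↮ s₂)`.
* `knLemma4_pair_glued` (**eq. (9)**, the only printed inequality about DRIFT): with `u/S` the weighting glued along a
  block `S` of two vertices (`blockGrowth_glue_real_openConn`),
  `μ_{u/S}(a₀ ↔ b) − μ_u(a₀ ↔ b) ≤ μ_u(S ↔ b) − μ_u(s ↔ b)` for some (hence the less reliable) `s ∈ S`: gluing a pair raises a third vertex's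
  reliability by no more than it raises the pair above its less reliable member.
* `blockKernel_pair_of_shallow` (**the shallow leaf**): the two-block kernel
  `μ(a₀↔b) + μ(a₀↮b, a₀↔S, S↔b) ≤ μ(S↔b) + Σ_{W∩A=∅} μ(K_S = W)·μ(sel W ↔ b in Wᶜ)` (conclusion of `hres` verbatim)
  holds for `S.card = 2` whenever the reliability gap `μ(a₀↔b) − min_{s∈S} μ(s↔b)` is at most the dead-pocket sum —
  no minimiser / badness / drift hypothesis is needed.  Numerically this is a rare sub-case of the drift residue
  (`Cruxes/AdditiveGluing/LITERATURE.md` §4 T1: 1/48 drift instances at `n = 6`); the deep regime stays open.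
[cite: KozmaNitzan2024, Lemma 4 (p. 9), eq. (8)–(9) and Remark (pp. 9–10); Theorem 1 (§3.1)]
-/

namespace Summit.CriticalPhenomena.PercolationContinuityZ3.Theorems

open MeasureTheory Set
open Literature.Probability.LatticeModels (prodBernoulli)
open Literature.Probability.Percolation (BondConfig openConn openConnIn openGraph)
open scoped BigOperators

noncomputable section
open Classical

variable {n : ℕ}

/-- **KN Lemma 4, one orientation.**  If `μ(E ∩ {s₂ ↔ b}) ≤ μ(E ∩ {a₀ ↔ b})` for `E = {a₀ ↔ s₁} ∪ {a₀ ↔ s₂}`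
(the conclusion of KN Theorem 1 with observer `a₀` and relays `s₁, s₂` when the minimum sits at `s₂`), then
`μ(a₀ ↮ b, a₀ ↔ {s₁,s₂}, {s₁,s₂} ↔ b) ≤ μ({s₁ ↔ b} ∪ {s₂ ↔ b}) − μ(s₂ ↔ b)`.
Event algebra of the printed proof: split along `{a₀ ↔ s₂}`, on which the two events of the hypothesis coincide; the
pivotality event is covered by `(E ∩ {s₂↔b}) ∖ {a₀↔s₂}` and `{a₀ ↮ s₁, a₀ ↔ s₂, s₁ ↔ b}`, and
`((E ∩ {a₀↔b}) ∖ {a₀↔s₂}) ⊔ {a₀ ↮ s₁, a₀ ↔ s₂, s₁ ↔ b} ⊆ {s₁ ↔ b} ∖ {s₂ ↔ b}`.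
[cite: KozmaNitzan2024, Lemma 4 (p. 9), proof] -/
theorem knLemma4_pair_core (w : Sym2 (Fin n) → unitInterval) (a₀ s₁ s₂ b : Fin n)
    (h : (prodBernoulli w).real ((openConn a₀ s₁ ∪ openConn a₀ s₂) ∩ openConn s₂ b) ≤
      (prodBernoulli w).real ((openConn a₀ s₁ ∪ openConn a₀ s₂) ∩ openConn a₀ b)) :
    (prodBernoulli w).real
        ((openConn a₀ b)ᶜ ∩ (openConn a₀ s₁ ∪ openConn a₀ s₂) ∩ (openConn s₁ b ∪ openConn s₂ b)) ≤
      (prodBernoulli w).real (openConn s₁ b ∪ openConn s₂ b)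
        - (prodBernoulli w).real (openConn s₂ b) := by
  have hmM : MeasurableSet (openConn a₀ s₂ : Set (BondConfig (Fin n))) := MeasurableSet.of_discrete
  -- split both sides of `h` along `M = {a₀ ↔ s₂}`
  have h2 := measureReal_inter_add_sdiff (μ := prodBernoulli w)
    (s := (openConn a₀ s₁ ∪ openConn a₀ s₂) ∩ openConn s₂ b) hmM
  have h0 := measureReal_inter_add_sdiff (μ := prodBernoulli w)
    (s := (openConn a₀ s₁ ∪ openConn a₀ s₂) ∩ openConn a₀ b) hmM
  -- on `M` the two events coincide
  have hcap : ((openConn a₀ s₁ ∪ openConn a₀ s₂) ∩ openConn s₂ b) ∩ openConn a₀ s₂ =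
      (((openConn a₀ s₁ ∪ openConn a₀ s₂) ∩ openConn a₀ b) ∩ openConn a₀ s₂ :
        Set (BondConfig (Fin n))) := by
    ext ω
    constructor
    · rintro ⟨⟨hE, h2b⟩, hM⟩
      exact ⟨⟨hE, SimpleGraph.Reachable.trans hM h2b⟩, hM⟩
    · rintro ⟨⟨hE, h0b⟩, hM⟩
      exact ⟨⟨hE, SimpleGraph.Reachable.trans (SimpleGraph.Reachable.symm hM) h0b⟩, hM⟩
  have hYX : (prodBernoulli w).real (((openConn a₀ s₁ ∪ openConn a₀ s₂) ∩ openConn s₂ b) \ openConn a₀ s₂) ≤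
      (prodBernoulli w).real (((openConn a₀ s₁ ∪ openConn a₀ s₂) ∩ openConn a₀ b) \ openConn a₀ s₂) := by
    rw [hcap] at h2
    linarith
  -- the pivotality event is covered by `Y ∪ G₂`
  have hcover : (openConn a₀ b)ᶜ ∩ (openConn a₀ s₁ ∪ openConn a₀ s₂) ∩ (openConn s₁ b ∪ openConn s₂ b) ⊆
      (((openConn a₀ s₁ ∪ openConn a₀ s₂) ∩ openConn s₂ b) \ openConn a₀ s₂) ∪
        ((openConn a₀ s₁)ᶜ ∩ openConn a₀ s₂ ∩ openConn s₁ b) := by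
    rintro ω ⟨⟨h0b, hE⟩, hSb⟩
    by_cases h01 : ω ∈ (openConn a₀ s₁ : Set (BondConfig (Fin n)))
    · left
      have hs1b : ω ∉ (openConn s₁ b : Set (BondConfig (Fin n))) := fun hs1b =>
        h0b (SimpleGraph.Reachable.trans h01 hs1b)
      have hs2b : ω ∈ (openConn s₂ b : Set (BondConfig (Fin n))) := by
        rcases hSb with h' | h'
        · exact absurd h' hs1b
        · exact h'
      exact ⟨⟨hE, hs2b⟩, fun h02 => h0b (SimpleGraph.Reachable.trans h02 hs2b)⟩
    · right
      have h02 : ω ∈ (openConn a₀ s₂ : Set (BondConfig (Fin n))) := by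
        rcases hE with h' | h'
        · exact absurd h' h01
        · exact h'
      have hs2b : ω ∉ (openConn s₂ b : Set (BondConfig (Fin n))) := fun hs2b =>
        h0b (SimpleGraph.Reachable.trans h02 hs2b)
      have hs1b : ω ∈ (openConn s₁ b : Set (BondConfig (Fin n))) := by
        rcases hSb with h' | h'
        · exact h'
        · exact absurd h' hs2b
      exact ⟨⟨h01, h02⟩, hs1b⟩
  -- `X ∪ G₂ ⊆ {S ↔ b} ∖ {s₂ ↔ b}`
  have hXG : (((openConn a₀ s₁ ∪ openConn a₀ s₂) ∩ openConn a₀ b) \ openConn a₀ s₂) ∪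
        ((openConn a₀ s₁)ᶜ ∩ openConn a₀ s₂ ∩ openConn s₁ b) ⊆
      ((openConn s₁ b ∪ openConn s₂ b) \ openConn s₂ b : Set (BondConfig (Fin n))) := by
    rintro ω (⟨⟨hE, h0b⟩, hM⟩ | ⟨⟨h01, h02⟩, hs1b⟩)
    · have h01 : ω ∈ (openConn a₀ s₁ : Set (BondConfig (Fin n))) := by
        rcases hE with h' | h'
        · exact h'
        · exact absurd h' hM
      refine ⟨Or.inl (SimpleGraph.Reachable.trans (SimpleGraph.Reachable.symm h01) h0b), ?_⟩
      intro hs2b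
      exact hM (SimpleGraph.Reachable.trans h0b (SimpleGraph.Reachable.symm hs2b))
    · refine ⟨Or.inl hs1b, ?_⟩
      intro hs2b
      exact h01 (SimpleGraph.Reachable.trans (SimpleGraph.Reachable.trans h02 hs2b)
        (SimpleGraph.Reachable.symm hs1b))
  have hdisj : Disjoint (((openConn a₀ s₁ ∪ openConn a₀ s₂) ∩ openConn a₀ b) \ openConn a₀ s₂)
      ((openConn a₀ s₁)ᶜ ∩ openConn a₀ s₂ ∩ openConn s₁ b : Set (BondConfig (Fin n))) := by
    rw [Set.disjoint_left]
    rintro ω ⟨⟨hE, -⟩, hM⟩ ⟨⟨h01, -⟩, -⟩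
    rcases hE with h' | h'
    · exact h01 h'
    · exact hM h'
  have hmG : MeasurableSet ((openConn a₀ s₁)ᶜ ∩ openConn a₀ s₂ ∩ openConn s₁ b : Set (BondConfig (Fin n))) :=
    MeasurableSet.of_discrete
  have hunion := measureReal_union (μ := prodBernoulli w) hdisj hmG
  have hm2 : MeasurableSet (openConn s₂ b : Set (BondConfig (Fin n))) := MeasurableSet.of_discrete
  have hU := measureReal_inter_add_sdiff (μ := prodBernoulli w) (s := openConn s₁ b ∪ openConn s₂ b) hm2
  have hUcap : (openConn s₁ b ∪ openConn s₂ b) ∩ openConn s₂ b = (openConn s₂ b : Set (BondConfig (Fin n))) :=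
    Set.inter_eq_right.2 Set.subset_union_right
  rw [hUcap] at hU
  have hc := measureReal_mono (μ := prodBernoulli w) hcover
  have hsub := measureReal_union_le (μ := prodBernoulli w)
    (((openConn a₀ s₁ ∪ openConn a₀ s₂) ∩ openConn s₂ b) \ openConn a₀ s₂)
    ((openConn a₀ s₁)ᶜ ∩ openConn a₀ s₂ ∩ openConn s₁ b)
  have hx := measureReal_mono (μ := prodBernoulli w) hXG
  linarith

/-- **Kozma–Nitzan Lemma 4, eq. (8) (pair pivotality).**  For all vertices `a₀, s₁, s₂, b` of a finite weighted graph,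
`μ(a₀ ↮ b, a₀ ↔ {s₁,s₂}, {s₁,s₂} ↔ b) ≤ μ({s₁ ↔ b} ∪ {s₂ ↔ b}) − min (μ(s₁ ↔ b), μ(s₂ ↔ b))`, i.e.
`P({s₁,s₂} pivotal for a₀ ↔ b) ≤ max_j P({s₁,s₂} pivotal for s_j ↔ b)`.  From KN Theorem 1 for the observer `{a₀}`
and relays `s₁, s₂` (`stub_knThm1Set`) and `knLemma4_pair_core` in the orientation selected by the minimum.
[cite: KozmaNitzan2024, Lemma 4 (p. 9), eq. (8)] -/
theorem knLemma4_pair (w : Sym2 (Fin n) → unitInterval) (a₀ s₁ s₂ b : Fin n) :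
    (prodBernoulli w).real
        ((openConn a₀ b)ᶜ ∩ (openConn a₀ s₁ ∪ openConn a₀ s₂) ∩ (openConn s₁ b ∪ openConn s₂ b)) ≤
      (prodBernoulli w).real (openConn s₁ b ∪ openConn s₂ b)
        - min ((prodBernoulli w).real (openConn s₁ b)) ((prodBernoulli w).real (openConn s₂ b)) := by
  have hT := stub_knThm1Set n w {a₀} s₁ s₂ b
  simp only [Finset.set_biUnion_singleton] at hT
  rcases min_le_iff.1 hT with h1 | h2
  · -- the minimum sits at `s₁`: use the core lemma with the roles of `s₁, s₂` exchanged
    have e1 : (openConn a₀ s₂ ∪ openConn a₀ s₁ : Set (BondConfig (Fin n))) = openConn a₀ s₁ ∪ openConn a₀ s₂ :=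
      Set.union_comm _ _
    have e2 : (openConn s₂ b ∪ openConn s₁ b : Set (BondConfig (Fin n))) = openConn s₁ b ∪ openConn s₂ b :=
      Set.union_comm _ _
    have hcore := knLemma4_pair_core w a₀ s₂ s₁ b (by rw [e1]; exact h1)
    rw [e1, e2] at hcore
    have hmin : min ((prodBernoulli w).real (openConn s₁ b)) ((prodBernoulli w).real (openConn s₂ b)) ≤
        (prodBernoulli w).real (openConn s₁ b) := min_le_left _ _
    linarith
  · have hcore := knLemma4_pair_core w a₀ s₁ s₂ b h2
    have hmin : min ((prodBernoulli w).real (openConn s₁ b)) ((prodBernoulli w).real (openConn s₂ b)) ≤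
        (prodBernoulli w).real (openConn s₂ b) := min_le_right _ _
    linarith

/-- **Kozma–Nitzan Lemma 4 for a two-vertex block `S`** (Finset form): for SOME `s ∈ S` (the orientation selected by
KN Theorem 1; by the printed Remark p. 10 it cannot be prescribed),
`μ(a₀ ↮ b, a₀ ↔ S, S ↔ b) ≤ μ(S ↔ b) − μ(s ↔ b)`; a fortiori the bound holds with `min_{s ∈ S} μ(s ↔ b)`.
[cite: KozmaNitzan2024, Lemma 4 (p. 9), eq. (8)] -/
theorem knLemma4_block_two (w : Sym2 (Fin n) → unitInterval) (S : Finset (Fin n)) (a₀ b : Fin n)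
    (hS : S.card = 2) :
    ∃ s ∈ S, (prodBernoulli w).real
        ((openConn a₀ b)ᶜ ∩ (⋃ s ∈ S, openConn a₀ s) ∩ (⋃ s ∈ S, openConn s b)) ≤
      (prodBernoulli w).real (⋃ s ∈ S, openConn s b) - (prodBernoulli w).real (openConn s b) := by
  obtain ⟨s₁, s₂, hne, rfl⟩ := Finset.card_eq_two.1 hS
  rw [blockGrowth_biUnion_pair_right s₁ s₂ a₀, blockGrowth_biUnion_pair_left s₁ s₂ b]
  have h4 := knLemma4_pair w a₀ s₁ s₂ b
  rcases le_total ((prodBernoulli w).real (openConn s₁ b)) ((prodBernoulli w).real (openConn s₂ b)) with h | h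
  · refine ⟨s₁, by simp, ?_⟩
    rw [min_eq_left h] at h4
    exact h4
  · refine ⟨s₂, by simp, ?_⟩
    rw [min_eq_right h] at h4
    exact h4

/-- **Kozma–Nitzan eq. (9): the drift gain of gluing a pair.**  With `u/S` the weighting `u` glued along a block `S`
of two vertices (all pairs inside `S` given weight `1`), for some `s ∈ S` (hence for the less reliable one):
`μ_{u/S}(a₀ ↔ b) − μ_u(a₀ ↔ b) ≤ μ_u(S ↔ b) − μ_u(s ↔ b)` — gluing the pair raises the reliability of a third vertex
`a₀` by no more than it raises the pair above its less reliable member (`μ_u(S ↔ b) = μ_{u/S}(s ↔ b)`).  The printed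
remark (p. 10) shows the `min`/`∀ s` cannot be replaced by the better member.
[cite: KozmaNitzan2024, eq. (9) and Remark (pp. 9–10)] -/
theorem knLemma4_pair_glued (u : Sym2 (Fin n) → unitInterval) (S : Finset (Fin n)) (a₀ b : Fin n)
    (hS : S.card = 2) :
    ∃ s ∈ S, (prodBernoulli (fun e : Sym2 (Fin n) =>
        if (∀ x ∈ e, x ∈ S) ∧ ¬ e.IsDiag then 1 else u e)).real (openConn a₀ b)
        - (prodBernoulli u).real (openConn a₀ b) ≤
      (prodBernoulli u).real (⋃ s ∈ S, openConn s b) - (prodBernoulli u).real (openConn s b) := by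
  obtain ⟨s, hs, h⟩ := knLemma4_block_two u S a₀ b hS
  refine ⟨s, hs, ?_⟩
  rw [blockGrowth_glue_real_openConn u S a₀ b]
  linarith

/-- **The shallow leaf of the two-block kernel.**  For ANY weighting `u`, relay set `A`, target `b`, designated relay
`a₀`, selection `sel` and block `S` with `S.card = 2`: if the reliability gap between `a₀` and each block vertex is at
most the dead-pocket sum, `μ(a₀ ↔ b) − μ(s ↔ b) ≤ Σ_{W ∩ A = ∅} μ(K_S = W)·μ(sel W ↔ b in Wᶜ)` for every `s ∈ S`, then the
residual kernel inequality (conclusion of `hres` of `goodStep_of_residualKernel`, verbatim) holds: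
`μ(a₀↔b) + μ(a₀↮b, a₀↔S, S↔b) ≤ μ(S↔b) + Σ_{W ∩ A = ∅} μ(K_S = W)·μ(sel W ↔ b in Wᶜ)`.
Proof: Kozma–Nitzan Lemma 4 bounds the second summand by `μ(S↔b) − μ(s↔b)` for some `s ∈ S`.
[cite: KozmaNitzan2024, Lemma 4 (p. 9), eq. (8)–(9)] -/
theorem blockKernel_pair_of_shallow (u : Sym2 (Fin n) → unitInterval) (A S : Finset (Fin n)) (b a₀ : Fin n)
    (sel : Finset (Fin n) → Fin n) (hS : S.card = 2)
    (hshallow : ∀ s ∈ S, (prodBernoulli u).real (openConn a₀ b) - (prodBernoulli u).real (openConn s b) ≤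
      ∑ W ∈ (Finset.univ : Finset (Finset (Fin n))).filter (fun W => Disjoint W A),
        (prodBernoulli u).real {ω : BondConfig (Fin n) | ∀ z : Fin n, (z ∈ W ↔ ω ∈ ⋃ s ∈ S, openConn s z)}
          * (prodBernoulli u).real (openConnIn ((W : Set (Fin n))ᶜ) (sel W) b)) :
    (prodBernoulli u).real (openConn a₀ b)
        + (prodBernoulli u).real ((openConn a₀ b)ᶜ ∩ (⋃ s ∈ S, openConn a₀ s) ∩ (⋃ s ∈ S, openConn s b))
      ≤ (prodBernoulli u).real (⋃ s ∈ S, openConn s b)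
        + ∑ W ∈ (Finset.univ : Finset (Finset (Fin n))).filter (fun W => Disjoint W A),
            (prodBernoulli u).real {ω : BondConfig (Fin n) | ∀ z : Fin n, (z ∈ W ↔ ω ∈ ⋃ s ∈ S, openConn s z)}
              * (prodBernoulli u).real (openConnIn ((W : Set (Fin n))ᶜ) (sel W) b) := by
  obtain ⟨s₁, hs₁, h4⟩ := knLemma4_block_two u S a₀ b hS
  have hsh := hshallow s₁ hs₁
  linarith

/-- Registered helper stub `stub_knLemma4Pair_v13181` (TTRL deep seat V13181): Kozma–Nitzan Lemma 4 / eq. (8), pair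
pivotality, verbatim `knLemma4_pair` in closed form; discharges the filed item wi-38625 in the crux's model.
[cite: KozmaNitzan2024, Lemma 4 (p. 9), eq. (8)] -/
theorem stub_knLemma4Pair_v13181 : ∀ (n : ℕ) (w : Sym2 (Fin n) → unitInterval) (a₀ s₁ s₂ b : Fin n), (prodBernoulli w).real ((openConn a₀ b)ᶜ ∩ (openConn a₀ s₁ ∪ openConn a₀ s₂) ∩ (openConn s₁ b ∪ openConn s₂ b)) ≤ (prodBernoulli w).real (openConn s₁ b ∪ openConn s₂ b) - min ((prodBernoulli w).real (openConn s₁ b)) ((prodBernoulli w).real (openConn s₂ b)) :=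
  fun _ w a₀ s₁ s₂ b => knLemma4_pair w a₀ s₁ s₂ b

/-- Registered helper stub `stub_blockKernelPairShallow_v13181` (TTRL deep seat V13181): the shallow leaf of the
two-block residual kernel, verbatim `blockKernel_pair_of_shallow` in closed form.
[cite: KozmaNitzan2024, Lemma 4 (p. 9), eq. (8)–(9)] -/
theorem stub_blockKernelPairShallow_v13181 : ∀ (n : ℕ) (u : Sym2 (Fin n) → unitInterval) (A S : Finset (Fin n)) (b a₀ : Fin n) (sel : Finset (Fin n) → Fin n), S.card = 2 → (∀ s ∈ S, (prodBernoulli u).real (openConn a₀ b) - (prodBernoulli u).real (openConn s b) ≤ ∑ W ∈ (Finset.univ : Finset (Finset (Fin n))).filter (fun W => Disjoint W A), (prodBernoulli u).real {ω : BondConfig (Fin n) | ∀ z : Fin n, (z ∈ W ↔ ω ∈ ⋃ s ∈ S, openConn s z)} * (prodBernoulli u).real (openConnIn ((W : Set (Fin n))ᶜ) (sel W) b)) → (prodBernoulli u).real (openConn a₀ b) + (prodBernoulli u).real ((openConn a₀ b)ᶜ ∩ (⋃ s ∈ S, openConn a₀ s) ∩ (⋃ s ∈ S, openConn s b)) ≤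 (prodBernoulli u).real (⋃ s ∈ S, openConn s b) + ∑ W ∈ (Finset.univ : Finset (Finset (Fin n))).filter (fun W => Disjoint W A), (prodBernoulli u).real {ω : BondConfig (Fin n) | ∀ z : Fin n, (z ∈ W ↔ ω ∈ ⋃ s ∈ S, openConn s z)} * (prodBernoulli u).real (openConnIn ((W : Set (Fin n))ᶜ) (sel W) b) :=
  fun _ u A S b a₀ sel hS hshallow => blockKernel_pair_of_shallow u A S b a₀ sel hS hshallow

end

end Summit.CriticalPhenomena.PercolationContinuityZ3.Theorems
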